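import Summits.CriticalPhenomena.PercolationContinuityZ3.Theorems.PercNonProliferationFreeBoxPowerSavingOneArmDictionary
import Summits.CriticalPhenomena.PercolationContinuityZ3.Theorems.PercNearOneGluingNoHeavyQuantThetaModulusR4
import HarnessLib

/-!
# The RSW-type leaves of rung R3 give (T1) AND (T2) in `d = 3`: `X_B ⇒ OneArmPolyDecay 3 ⇒ ThetaHolderNearCritical 3 b C'`

builds on p205010 (kernel theorem, internal audit signed; external expert review pending).
Status sentence for p205010: "θ(p_c) = 0 on ℤ^d, all d ≥ 2 — kernel-verified (Lean 4/Mathlib, standard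
axioms); internal adversarial audit SIGNED 2026-08-20 04:29Z; external expert review pending."

Seat `prim-quant-p4`, `--supports stmt-CriticalPhenomena-4575`; pure proofs (compositions).  The lane's LADDER (R3):
the tree already proves `X_B ⇒` polynomial one-arm rate at `p_c(ℤ³)`
(`FreeBoxPowerSavingLine.OneArmDictionary.oneArm_rate_of_critAnnulusNonCrossing`) and `Cesàro blocking ⇒` rate
(`FreeBoxPowerSavingLine.stub_cesaroBlockingGivesOneArm`), where `X_B = PercAnnulusCrossing.CritAnnulusNonCrossing`
(stmt-CriticalPhenomena-0846, OPEN: uniform annulus non-crossing at `p_c`).  Composed with R4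
(`ThetaModulus.exists_thetaHolderNearCritical_of_oneArmPolyDecay`, exponent `2c/(c+3)`), each leaf yields the lane's
two targets at once, in the lane's vocabulary:

* `oneArmPolyDecay_three_of_critAnnulusNonCrossing : X_B → Quant.OneArmPolyDecay 3` ((T1), bridge to R0.a);
* `oneArmPolyDecay_three_of_cesaroBlocking` (the weaker Cesàro leaf, hypothesis verbatim as in the tree);
* `exists_thetaHolderNearCritical_of_critAnnulusNonCrossing : X_B → ∃ b > 0, ∃ C', Quant.ThetaHolderNearCritical 3 b C'`
  and the `ThetaModulusNearCritical` form ((T2)); likewise from Cesàro blocking.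

Also, for numerical use by the census seats, the `ε–δ` reading of the critical modulus:
`theta_le_of_oneArm_le_quarter` (`π_{p_c}(n) ≤ ε/4` and `p − p_c ≤ √ε/(2K_n)` give `θ(p) ≤ ε`).

Honest scope: `X_B` and Cesàro blocking at `p_c(ℤ³)` are OPEN (no 3D RSW in print); these are reductions.  New as
compositions only.
-/

noncomputable section

namespace Summit.CriticalPhenomena.PercolationContinuityZ3.Theorems

namespace ThetaModulus

open MeasureTheory Set Filter Topology Literature.Probability.Percolation Literature.Probability.LatticeModels
open Summit.CriticalPhenomena.PercolationContinuityZ3.FreeBoxPowerSavingLine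

/-- **`X_B ⇒ (T1)` in the lane's vocabulary**: uniform annulus non-crossing at `p_c(ℤ³)` gives
`Quant.OneArmPolyDecay 3` (the tree's `OneArmDictionary.oneArm_rate_of_critAnnulusNonCrossing`, re-typed; `oneArmProb`
unfolds to the measure of `siteToBoundary` by `rfl`).  Conditional on the open leaf `X_B`. -/
theorem oneArmPolyDecay_three_of_critAnnulusNonCrossing
    (hXB : Summit.CriticalPhenomena.PercolationContinuityZ3.Theses.PercAnnulusCrossing.CritAnnulusNonCrossing) :
    Quant.OneArmPolyDecay 3 := by
  obtain ⟨s, C, hs, h⟩ := OneArmDictionary.oneArm_rate_of_critAnnulusNonCrossing hXB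
  exact ⟨s, hs, C, fun n hn => h n hn⟩

/-- **Cesàro blocking at `p_c(ℤ³)` ⇒ (T1)** in the lane's vocabulary (the tree's
`stub_cesaroBlockingGivesOneArm` at `p = p_c`, hypothesis verbatim: `∃ c > 0, ∀ᶠ K, c·K ≤ Σ_{j<K} u_{2^j}(p_c)` with
`u_n(p) = P_p(no open crossing Λ_n ↔ ∂Λ_{2n} inside Λ_{2n})`).  Conditional on the open Cesàro leaf. -/
theorem oneArmPolyDecay_three_of_cesaroBlocking
    (h : ∃ c : ℝ, 0 < c ∧ ∀ᶠ K : ℕ in atTop, c * (K : ℝ) ≤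
      ∑ j ∈ Finset.range K, (bondPercolation (zdGraph 3) (criticalProbI 3)).real
        {ω | ¬ ∃ x ∈ box 3 (2 ^ j), ∃ y ∈ innerBoundary (zdGraph 3) (box 3 (2 * 2 ^ j)),
          ω ∈ openConnIn (↑(box 3 (2 * 2 ^ j)) : Set (Site 3)) x y}) :
    Quant.OneArmPolyDecay 3 := by
  obtain ⟨s, C, hs, h'⟩ := stub_cesaroBlockingGivesOneArm (criticalProbI 3) h
  exact ⟨s, hs, C, fun n hn => h' n hn⟩

/-- **`X_B ⇒ (T2)`, Hölder form**: uniform annulus non-crossing at `p_c(ℤ³)` gives an explicit Hölder modulus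
`θ(p) ≤ C' (p − p_c)^b` on `[p_c, 1]` with `b = 2s/(s+3) > 0` for the one-arm exponent `s` the tree extracts from `X_B`.
Composition of `oneArmPolyDecay_three_of_critAnnulusNonCrossing` with R4
(`exists_thetaHolderNearCritical_of_oneArmPolyDecay`).  Conditional on the open leaf `X_B`.
builds on p205010 (kernel theorem, internal audit signed; external expert review pending). -/
theorem exists_thetaHolderNearCritical_of_critAnnulusNonCrossing
    (hXB : Summit.CriticalPhenomena.PercolationContinuityZ3.Theses.PercAnnulusCrossing.CritAnnulusNonCrossing) :
    ∃ b : ℝ, 0 < b ∧ ∃ C' : ℝ, Quant.ThetaHolderNearCritical 3 b C' :=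
  exists_thetaHolderNearCritical_of_oneArmPolyDecay (by norm_num)
    (oneArmPolyDecay_three_of_critAnnulusNonCrossing hXB)

/-- **`X_B ⇒ (T2)`, modulus form** (`Quant.ThetaModulusNearCritical 3 (t ↦ C' t^b)`).  Conditional on `X_B`.
builds on p205010 (kernel theorem, internal audit signed; external expert review pending). -/
theorem exists_thetaModulusNearCritical_of_critAnnulusNonCrossing
    (hXB : Summit.CriticalPhenomena.PercolationContinuityZ3.Theses.PercAnnulusCrossing.CritAnnulusNonCrossing) :
    ∃ b C' : ℝ, 0 < b ∧ Quant.ThetaModulusNearCritical 3 (fun t => C' * t ^ b) :=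
  exists_thetaModulusNearCritical_of_oneArmPolyDecay (by norm_num)
    (oneArmPolyDecay_three_of_critAnnulusNonCrossing hXB)

/-- **Cesàro blocking at `p_c(ℤ³)` ⇒ (T2)**, Hölder form.  Conditional on the open Cesàro leaf.
builds on p205010 (kernel theorem, internal audit signed; external expert review pending). -/
theorem exists_thetaHolderNearCritical_of_cesaroBlocking
    (h : ∃ c : ℝ, 0 < c ∧ ∀ᶠ K : ℕ in atTop, c * (K : ℝ) ≤
      ∑ j ∈ Finset.range K, (bondPercolation (zdGraph 3) (criticalProbI 3)).real
        {ω | ¬ ∃ x ∈ box 3 (2 ^ j), ∃ y ∈ innerBoundary (zdGraph 3) (box 3 (2 * 2 ^ j)),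
          ω ∈ openConnIn (↑(box 3 (2 * 2 ^ j)) : Set (Site 3)) x y}) :
    ∃ b : ℝ, 0 < b ∧ ∃ C' : ℝ, Quant.ThetaHolderNearCritical 3 b C' :=
  exists_thetaHolderNearCritical_of_oneArmPolyDecay (by norm_num) (oneArmPolyDecay_three_of_cesaroBlocking h)

/-! ### An `ε–δ` form for numerical use (census-2): `θ(p) ≤ ε` once `π_{p_c}(n) ≤ ε/4` and `p − p_c ≤ √ε/(2K_n)` -/

/-- **Semi-explicit `ε–δ` continuity at `p_c⁺`.**  For `d ≥ 2`, `p_c ≤ p ≤ (1+p_c)/2`, any scale `n` with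
`π_{p_c}(n) ≤ ε/4`, and `(p − p_c)·K_n ≤ √ε/2` where `K_n = √(#E(Λ_n)/(2p_c(1−p_c)))`, one has `θ(p) ≤ ε`
(from `theta_le_sq_sqrt_oneArm_critical`: `(√(ε/4) + √ε/2)² = ε`).  With a (numerical or proved) value of
`π_{p_c}(n)` this is an explicit `δ(ε) = min((1−p_c)/2, √ε/(2K_n))`.  New (bookkeeping). -/
theorem theta_le_of_oneArm_le_quarter {d : ℕ} (hd : 2 ≤ d) (p : unitInterval)
    (hpc : (criticalProbI d : ℝ) ≤ p) (hp : (p : ℝ) ≤ (1 + criticalProbI d) / 2) (n : ℕ) {ε : ℝ}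
    (hε : 0 ≤ ε) (hπ : oneArmProb d (criticalProbI d) n ≤ ε / 4)
    (hδ : ((p : ℝ) - criticalProbI d) *
      Real.sqrt ((((box d n).sym2.filter (· ∈ (zdGraph d).edgeSet)).card : ℝ) /
        (2 * (criticalProbI d : ℝ) * (1 - criticalProbI d))) ≤ Real.sqrt ε / 2) :
    theta (zdGraph d) 0 p ≤ ε := by
  refine (theta_le_sq_sqrt_oneArm_critical hd p hpc hp n).trans ?_
  have h1 : Real.sqrt (oneArmProb d (criticalProbI d) n) ≤ Real.sqrt ε / 2 := by
    calc Real.sqrt (oneArmProb d (criticalProbI d) n) ≤ Real.sqrt (ε / 4) := Real.sqrt_le_sqrt hπ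
      _ = Real.sqrt ε / 2 := by
          rw [Real.sqrt_div' ε (by norm_num : (0:ℝ) ≤ 4), show (4 : ℝ) = 2 ^ 2 by norm_num,
            Real.sqrt_sq (by norm_num : (0:ℝ) ≤ 2)]
  have hnn : 0 ≤ Real.sqrt (oneArmProb d (criticalProbI d) n) + ((p : ℝ) - criticalProbI d) *
      Real.sqrt ((((box d n).sym2.filter (· ∈ (zdGraph d).edgeSet)).card : ℝ) /
        (2 * (criticalProbI d : ℝ) * (1 - criticalProbI d))) := by
    have hs : 0 ≤ (p : ℝ) - criticalProbI d := by linarith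
    positivity
  calc (Real.sqrt (oneArmProb d (criticalProbI d) n) + ((p : ℝ) - criticalProbI d) *
        Real.sqrt ((((box d n).sym2.filter (· ∈ (zdGraph d).edgeSet)).card : ℝ) /
          (2 * (criticalProbI d : ℝ) * (1 - criticalProbI d)))) ^ 2
      ≤ (Real.sqrt ε / 2 + Real.sqrt ε / 2) ^ 2 := pow_le_pow_left₀ hnn (add_le_add h1 hδ) 2
    _ = ε := by rw [← two_mul, mul_div_cancel₀ _ (two_ne_zero), Real.sq_sqrt hε]

end ThetaModulus

end Summit.CriticalPhenomena.PercolationContinuityZ3.Theorems
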